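import Summits.PneNP.PneNP.Theorems.KarlinRubinMonotoneSufficesGreedyCircuitDefs

/-!
# Crux `MonotoneSuffices` (stmt-PneNP-18026), the GREEDY general detector — part 9a: semantics of the layered circuit

`t` iterations of the layer `layerW c` from `initW x` compute the true selection bits `selTrueW x c`
(`iterate_layerW_inr`), level by level: once the bits of the levels `< r` are true, the layer makes the bits of the
levels `≤ r` true (`newSelW_eq_selTrueW`), because the pool read off true bits is the pool of the run
(`forall_okLevelW_iff_mem_pool` while the run is alive, `exists_not_okLevelW_of_dead` after it died). Consequently
the verdict read off the final wires is the trial's verdict (`verdictW_iterate_eq_trialOut`).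
-/

set_option linter.dupNamespace false -- `Summit.PneNP.PneNP.…`: summit = sub-problem name (D-0017 single-conjunct layout)

namespace Summit.PneNP.PneNP.Theorems.MonotoneSuffices.Greedy

open Finset
open Literature.Probability.RandomGraphs.PlantedClique

variable {n t M : ℕ}

/-! ### `find?` over `finRange` -/

/-- The first index satisfying `p`. [folklore] -/
theorem find?_finRange_eq_some_iff (p : Fin M → Bool) (m : Fin M) :
    (List.finRange M).find? p = some m ↔ p m = true ∧ ∀ m' : Fin M, m'.1 < m.1 → p m' = false := by
  rw [List.find?_eq_some_iff_getElem]
  constructor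
  · rintro ⟨hp, j, hj, hjm, hbefore⟩
    have hjv : j = m.1 := by have := congrArg Fin.val hjm; simpa using this
    refine ⟨hp, fun m' hm' => ?_⟩
    have := hbefore m'.1 (by rw [hjv]; exact hm')
    simpa using this
  · rintro ⟨hp, hbefore⟩
    refine ⟨hp, m.1, by simp, by simp, fun j hj => ?_⟩
    have := hbefore ⟨j, lt_trans hj m.2⟩ hj
    simpa using this

/-! ### The run: alive levels and picks -/

/-- If the run is alive after `j` levels it was alive after `i ≤ j` levels. [folklore] -/
theorem run_isSome_of_le (x : EdgeVec n) (c : Fin t → Fin M → Fin n) {i j : ℕ} (hij : i ≤ j)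
    (h : ∃ T, run x c j = some T) : ∃ T, run x c i = some T := by
  induction j, hij using Nat.le_induction with
  | base => exact h
  | succ j _ ih =>
      apply ih
      obtain ⟨T', hT'⟩ := h
      by_cases hjt : j < t
      · obtain ⟨T, v, hT, -, -⟩ := (run_succ_eq_some_iff x c hjt T').1 hT'
        exact ⟨T, hT⟩
      · rw [run_succ_of_le x c (not_lt.1 hjt)] at hT'
        exact ⟨T', hT'⟩

/-- A level picks iff the run survives it. [folklore] -/
theorem pickIdx_isSome_iff (x : EdgeVec n) (c : Fin t → Fin M → Fin n) (i : Fin t) :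
    (∃ m, pickIdx x c i = some m) ↔ ∃ T, run x c (i.1 + 1) = some T := by
  rw [run_succ_eq_pickIdx]
  cases hr : run x c i.1 with
  | none => simp [pickIdx, hr]
  | some T =>
      simp only [Option.bind_some, Option.map_eq_some_iff]
      constructor
      · rintro ⟨m, hm⟩; exact ⟨_, m, hm, rfl⟩
      · rintro ⟨_, m, hm, -⟩; exact ⟨m, hm⟩

/-- **The picks of an alive run**: after `i ≤ t` levels the run holds exactly the candidates picked so far.
[folklore] -/
theorem mem_run_iff (x : EdgeVec n) (c : Fin t → Fin M → Fin n) :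
    ∀ {i : ℕ}, i ≤ t → ∀ {T : Finset (Fin n)}, run x c i = some T →
      ∀ v : Fin n, v ∈ T ↔ ∃ j : Fin t, j.1 < i ∧ ∃ m, pickIdx x c j = some m ∧ c j m = v
  | 0, _, T, h, v => by
      rw [run_zero] at h; cases h
      simp
  | i + 1, hi, T', h, v => by
      have hit : i < t := hi
      rw [run_succ_eq_pickIdx x c ⟨i, hit⟩] at h
      cases hr : run x c i with
      | none => rw [hr] at h; simp at h
      | some T =>
          rw [hr, Option.bind_some] at h
          obtain ⟨m, hm, rfl⟩ := Option.map_eq_some_iff.1 h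
          rw [mem_insert, mem_run_iff x c (le_of_lt hit) hr v]
          constructor
          · rintro (rfl | ⟨j, hj, m', hm', rfl⟩)
            · exact ⟨⟨i, hit⟩, Nat.lt_succ_self _, m, hm, rfl⟩
            · exact ⟨j, Nat.lt_succ_of_lt hj, m', hm', rfl⟩
          · rintro ⟨j, hj, m', hm', hv⟩
            rcases Nat.lt_succ_iff_lt_or_eq.1 hj with hlt | heq
            · exact Or.inr ⟨j, hlt, m', hm', hv⟩
            · left
              have hji : j = ⟨i, hit⟩ := Fin.ext heq
              subst hji
              rw [hm] at hm'
              cases hm'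
              exact hv.symm

/-! ### Pools read off true bits -/

/-- Adjacency read off the wires depends only on the edge wires. [folklore] -/
theorem adjW_congr {w w' : (⊤ : SimpleGraph (Fin n)).edgeSet ⊕ (Fin t × Fin M) → Bool}
    (h : ∀ e, w (Sum.inl e) = w' (Sum.inl e)) (v u : Fin n) : adjW w v u = adjW w' v u := by
  unfold adjW; split_ifs <;> simp [h]

/-- Pool membership is adjacency, read off the initial wires, to every member. [folklore] -/
theorem mem_pool_iff_adjW (x : EdgeVec n) (T : Finset (Fin n)) (v : Fin n) :
    v ∈ pool x T ↔ ∀ u ∈ T, adjW (initW x : (⊤ : SimpleGraph (Fin n)).edgeSet ⊕ (Fin t × Fin M) → Bool) v u = true := by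
  classical
  rw [mem_pool]
  constructor
  · rintro ⟨hvT, hadj⟩ u hu
    have hvu : v ≠ u := fun h => hvT (h ▸ hu)
    rw [initW, adjW_inl x _ v u hvu]
    exact hadj _ (mem_filter.2 ⟨mem_univ _, u, hu, rfl⟩)
  · intro h
    refine ⟨fun hvT => ?_, fun e he => ?_⟩
    · have := h v hvT
      rw [adjW_self] at this
      cases this
    · obtain ⟨u, hu, heu⟩ := (mem_filter.1 he).2
      have hvu : v ≠ u := by
        intro hvu
        have hloop : (e : Sym2 (Fin n)).IsDiag := by rw [heu, hvu]; exact Sym2.mk_isDiag_iff.2 rfl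
        exact (SimpleGraph.not_isDiag_of_mem_edgeSet _ e.2) hloop
      have := h u hu
      rw [initW, adjW_inl x _ v u hvu] at this
      have hee : e = edgeOf v u hvu := Subtype.ext heu
      rw [hee]; exact this

/-- **The pool read off true bits, alive case.** If the edge wires are `x`, the selection bits of the levels `< i`
are the true ones and the run is alive after `i` levels with picks `T`, then admission by all levels `< i` is
membership in `pool x T`. [folklore] -/
theorem forall_okLevelW_iff_mem_pool (x : EdgeVec n) (c : Fin t → Fin M → Fin n)
    {w : (⊤ : SimpleGraph (Fin n)).edgeSet ⊕ (Fin t × Fin M) → Bool} {i : ℕ} (hi : i ≤ t)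
    (hinl : ∀ e, w (Sum.inl e) = x e) (hsel : ∀ p : Fin t × Fin M, p.1.1 < i → w (Sum.inr p) = selTrueW x c p)
    {T : Finset (Fin n)} (hT : run x c i = some T) (v : Fin n) :
    (∀ j : Fin t, j.1 < i → okLevelW c w j v = true) ↔ v ∈ pool x T := by
  have hadj : ∀ a b, adjW w a b = adjW (initW x : (⊤ : SimpleGraph (Fin n)).edgeSet ⊕ (Fin t × Fin M) → Bool) a b :=
    fun a b => adjW_congr (fun e => by rw [hinl, initW_inl]) a b
  rw [mem_pool_iff_adjW x T v]
  constructor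
  · intro h u hu
    obtain ⟨j, hj, m, hm, rfl⟩ := (mem_run_iff x c hi hT u).1 hu
    have hok := h j hj
    simp only [okLevelW, decide_eq_true_eq] at hok
    obtain ⟨m', hsel', hadj'⟩ := hok
    rw [hsel (j, m') hj, selTrueW, decide_eq_true_eq] at hsel'
    simp only at hsel'
    rw [hm] at hsel'
    cases hsel'
    rwa [hadj] at hadj'
  · intro h j hj
    -- level `j < i` is alive and picked
    obtain ⟨Tj1, hTj1⟩ := run_isSome_of_le x c (Nat.succ_le_of_lt hj) ⟨T, hT⟩
    obtain ⟨m, hm⟩ := (pickIdx_isSome_iff x c j).2 ⟨Tj1, hTj1⟩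
    simp only [okLevelW, decide_eq_true_eq]
    refine ⟨m, ?_, ?_⟩
    · rw [hsel (j, m) hj, selTrueW, decide_eq_true_eq]; exact hm
    · rw [hadj]
      exact h (c j m) ((mem_run_iff x c hi hT (c j m)).2 ⟨j, hj, m, hm, rfl⟩)

/-- **The pool read off true bits, dead case.** If the run is dead after `i` levels, no vertex is admitted by all
levels `< i`. [folklore] -/
theorem exists_not_okLevelW_of_dead (x : EdgeVec n) (c : Fin t → Fin M → Fin n)
    {w : (⊤ : SimpleGraph (Fin n)).edgeSet ⊕ (Fin t × Fin M) → Bool} {i : ℕ} (hi : i ≤ t)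
    (hsel : ∀ p : Fin t × Fin M, p.1.1 < i → w (Sum.inr p) = selTrueW x c p)
    (hT : run x c i = none) (v : Fin n) :
    ¬ ∀ j : Fin t, j.1 < i → okLevelW c w j v = true := by
  classical
  intro h
  -- some level `j < i` is dead right after it
  have hex : ∃ j, j < i ∧ run x c (j + 1) = none := by
    cases i with
    | zero => rw [run_zero] at hT; cases hT
    | succ i => exact ⟨i, Nat.lt_succ_self _, hT⟩
  -- take the least such `j`; the run is alive after `j` levels
  set j₀ := Nat.find hex with hj₀def
  have hj₀ : j₀ < i ∧ run x c (j₀ + 1) = none := Nat.find_spec hex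
  have hj₀t : j₀ < t := lt_of_lt_of_le hj₀.1 hi
  have hnone : pickIdx x c ⟨j₀, hj₀t⟩ = none := by
    cases hp : pickIdx x c ⟨j₀, hj₀t⟩ with
    | none => rfl
    | some m =>
        obtain ⟨T, hT'⟩ := (pickIdx_isSome_iff x c ⟨j₀, hj₀t⟩).1 ⟨m, hp⟩
        have : run x c (j₀ + 1) = some T := hT'
        rw [hj₀.2] at this; cases this
  have hok := h ⟨j₀, hj₀t⟩ hj₀.1
  simp only [okLevelW, decide_eq_true_eq] at hok
  obtain ⟨m', hsel', -⟩ := hok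
  rw [hsel (⟨j₀, hj₀t⟩, m') hj₀.1, selTrueW, decide_eq_true_eq] at hsel'
  have : pickIdx x c ⟨j₀, hj₀t⟩ = some m' := hsel'
  rw [hnone] at this; cases this

/-! ### One layer makes the next level true -/

/-- **The layer step.** If the edge wires are `x` and the selection bits of the levels `< r` are true, the new bit
of every `(i, m)` with `i ≤ r` is true. [folklore] -/
theorem newSelW_eq_selTrueW (x : EdgeVec n) (c : Fin t → Fin M → Fin n)
    {w : (⊤ : SimpleGraph (Fin n)).edgeSet ⊕ (Fin t × Fin M) → Bool} {r : ℕ}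
    (hinl : ∀ e, w (Sum.inl e) = x e) (hsel : ∀ p : Fin t × Fin M, p.1.1 < r → w (Sum.inr p) = selTrueW x c p)
    (p : Fin t × Fin M) (hp : p.1.1 ≤ r) : newSelW c w p = selTrueW x c p := by
  obtain ⟨i, m⟩ := p
  have hit : i.1 ≤ t := le_of_lt i.2
  have hsel' : ∀ q : Fin t × Fin M, q.1.1 < i.1 → w (Sum.inr q) = selTrueW x c q :=
    fun q hq => hsel q (lt_of_lt_of_le hq hp)
  cases hr : run x c i.1 with
  | none =>
      -- dead: no candidate is in the pool, no pick
      have hin : ∀ v, inPoolW c w i v = false := fun v => by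
        rw [inPoolW]
        exact decide_eq_false (exists_not_okLevelW_of_dead x c hit hsel' hr v)
      rw [newSelW, hin, Bool.false_and, selTrueW]
      symm
      apply decide_eq_false
      simp [pickIdx, hr]
  | some T =>
      have hin : ∀ v, inPoolW c w i v = decide (v ∈ pool x T) := fun v => by
        rw [inPoolW]
        exact (decide_eq_decide).2 (forall_okLevelW_iff_mem_pool x c hit hinl hsel' hr v)
      have hpick : pickIdx x c i = (List.finRange M).find? fun m => c i m ∈ pool x T := by
        simp [pickIdx, hr]
      have hgoal : newSelW c w (i, m) = true ↔ pickIdx x c i = some m := by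
        rw [hpick, find?_finRange_eq_some_iff, newSelW]
        simp only [hin, Bool.and_eq_true, decide_eq_true_eq, decide_eq_false_iff_not]
      rw [selTrueW]
      apply Bool.eq_iff_iff.2
      rw [hgoal, decide_eq_true_eq]

/-- **After `r` layers the bits of the levels `< r` are true.** [folklore] -/
theorem iterate_layerW_inr (x : EdgeVec n) (c : Fin t → Fin M → Fin n) :
    ∀ (r : ℕ) (p : Fin t × Fin M), p.1.1 < r → ((layerW c)^[r] (initW x)) (Sum.inr p) = selTrueW x c p
  | 0, _, hp => absurd hp (Nat.not_lt_zero _)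
  | r + 1, p, hp => by
      rw [Function.iterate_succ_apply', layerW_inr]
      exact newSelW_eq_selTrueW x c (iterate_layerW_inl c x r) (iterate_layerW_inr x c r) p (Nat.lt_succ_iff.1 hp)

/-! ### The verdict -/

/-- **The layered circuit computes the trial.** [folklore] -/
theorem verdictW_iterate_eq_trialOut (x : EdgeVec n) (c : Fin t → Fin M → Fin n) (θ : ℕ) :
    verdictW c θ ((layerW c)^[t] (initW x)) = trialOut x c θ := by
  classical
  set w := (layerW c)^[t] (initW x) with hw
  have hinl : ∀ e, w (Sum.inl e) = x e := iterate_layerW_inl c x t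
  have hsel : ∀ p : Fin t × Fin M, p.1.1 < t → w (Sum.inr p) = selTrueW x c p := iterate_layerW_inr x c t
  -- every level selected ↔ the run is alive after `t` levels
  have halive : (∀ i : Fin t, ∃ m : Fin M, w (Sum.inr (i, m)) = true) ↔ ∃ T, run x c t = some T := by
    constructor
    · intro h
      rcases Nat.eq_zero_or_pos t with ht | ht
      · subst ht; exact ⟨∅, run_zero x c⟩
      · obtain ⟨m, hm⟩ := h ⟨t - 1, by omega⟩
        rw [hsel (⟨t - 1, _⟩, m) (by simp; omega), selTrueW, decide_eq_true_eq] at hm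
        have h1 := (pickIdx_isSome_iff x c ⟨t - 1, by omega⟩).1 ⟨m, hm⟩
        have ht1 : t - 1 + 1 = t := by omega
        simpa [ht1] using h1
    · intro h i
      obtain ⟨T1, hT1⟩ := run_isSome_of_le x c (Nat.succ_le_of_lt i.2) h
      obtain ⟨m, hm⟩ := (pickIdx_isSome_iff x c i).2 ⟨T1, hT1⟩
      exact ⟨m, by rw [hsel (i, m) i.2, selTrueW, decide_eq_true_eq]; exact hm⟩
  apply Bool.eq_iff_iff.2
  rw [verdictW, decide_eq_true_eq, trialOut_eq_true_iff]
  cases hr : run x c t with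
  | none =>
      constructor
      · rintro ⟨h, -⟩
        obtain ⟨T, hT⟩ := halive.1 h
        rw [hr] at hT; cases hT
      · rintro ⟨T, hT, -⟩; cases hT
  | some T =>
      have hcnt : ((univ : Finset (Fin n)).filter fun u => cntBitW c w u = true) = (univ \ candSet c).filter (AdjAll x T) := by
        ext u
        simp only [mem_filter, mem_univ, true_and, mem_sdiff, cntBitW, decide_eq_true_eq]
        have hiff := forall_okLevelW_iff_mem_pool x c le_rfl hinl hsel hr u
        rw [mem_pool] at hiff
        constructor
        · rintro ⟨hu, h⟩
          exact ⟨hu, (hiff.1 fun j _ => h j).2⟩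
        · rintro ⟨hu, h⟩
          have hT : T ⊆ candSet c := run_subset_candSet x c t hr
          exact ⟨hu, fun j => (hiff.2 ⟨fun h' => hu (hT h'), h⟩) j j.2⟩
      rw [hcnt]
      constructor
      · rintro ⟨-, hθ⟩; exact ⟨T, rfl, hθ⟩
      · rintro ⟨T', hT', hθ⟩
        cases hT'
        exact ⟨halive.2 ⟨T, hr⟩, hθ⟩

end Summit.PneNP.PneNP.Theorems.MonotoneSuffices.Greedy

namespace Summit.PneNP.PneNP.Theorems.MonotoneSuffices.Greedy

/-- Registered sub-goal `greedy_circuit_sem` of stmt-PneNP-18026 (greedy detector, part 9a): the layered circuit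
computes the trial, exported verbatim. [folklore] -/
theorem greedy_circuit_sem :
    ∀ {n t M : ℕ} (x : Literature.Probability.RandomGraphs.PlantedClique.EdgeVec n) (c : Fin t → Fin M → Fin n) (θ : ℕ), Summit.PneNP.PneNP.Theorems.MonotoneSuffices.Greedy.verdictW c θ ((Summit.PneNP.PneNP.Theorems.MonotoneSuffices.Greedy.layerW c)^[t] (Summit.PneNP.PneNP.Theorems.MonotoneSuffices.Greedy.initW x)) = Summit.PneNP.PneNP.Theorems.MonotoneSuffices.Greedy.trialOut x c θ :=
  fun x c θ => verdictW_iterate_eq_trialOut x c θ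

end Summit.PneNP.PneNP.Theorems.MonotoneSuffices.Greedy
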